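import Mathlib
import HarnessLib
import Summits.AtomisticToContinuum.Crystallization.Theorems.PricedLinkCensusSoftFourRingsCapGlobal
import Summits.AtomisticToContinuum.Crystallization.Theorems.PricedLinkCensusSoftFourRingsCapSlackFacet
import Summits.AtomisticToContinuum.Crystallization.Theorems.PricedLinkCensusSoftFourRingsPathFamily
import Summits.AtomisticToContinuum.Crystallization.Theorems.PricedLinkCensusSoftFourRingsCounting
import Summits.AtomisticToContinuum.Crystallization.Theorems.PricedLinkCensusSoftFourRingsTightPrep

/-!
# Soft four-rings: preparations for the tightness count

Support file for `SoftFourRings` (route `PricedLinkCensus`, sub-problem `Crystallization`).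

Global setting: `X ⊂ S²` with `#X = 12`, pairwise `⟪·,·⟫ ≤ 1 − 1/(2·1.01²)`; a family `B` of 24 bond
pairs of close points, four at every vertex (the bond graph is 4-regular).  Notation (spelled out
in the statements): `nb(f)` = number of sides of the facet `f` outside `B`; a *bond triangle* is a
triangular facet with `nb = 0`; `t_v` = number of bond triangles at `v`; `V₃ = {v : t_v = 3}`;
a *slack triangle* is a triangular facet with `nb = 2`.

`exists_slackFacet_of_three` (CLAIM B in counting form), the per-facet bounds
`card_filter_on_nonbond_side_le(_two)` and `exists_nonbond_side_of_two`.

**`Cap` variant** (seat c3 of stmt-AtomisticToContinuum-14234): identical to `PricedLinkCensusSoftFourRingsTightPrep`, except that the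
global Tammes-13 hypothesis `(hT : musinTarasov2012_tammes_thirteen)` is replaced by the LOCAL covering
property of the twelve directions, `hT : ∀ p, ‖p‖ = 1 → ∃ x ∈ X, dist p x < 0.957` (no empty cap of
angular radius `57.18°`), which is all the two roots (`FacetCap`, `Interior`) ever used; the hT-free
lemmas are not repeated (the original file is imported for them).
-/

namespace Summit.AtomisticToContinuum.Crystallization.Theorems.Cap

open Real RealInnerProductSpace Literature.Geometry.DiscreteGeometry

section Setting

open scoped Classical in
/-- **CLAIM B at a vertex of `V₃`, in counting form**: a vertex with three bond triangles lies on
a non-bond side of a facet which is either a triangle with `nb ≥ 2` or a non-triangle with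
`nb ≥ 1`. -/
theorem exists_slackFacet_of_three
    {X : Finset (EuclideanSpace ℝ (Fin 3))}
    {B : Finset (Finset (EuclideanSpace ℝ (Fin 3)))}
    (hT : ∀ p : EuclideanSpace ℝ (Fin 3), ‖p‖ = 1 → ∃ x ∈ X, dist p x < 0.957)
    (hX1 : ∀ y ∈ X, ‖y‖ = 1)
    (hcard : X.card = 12)
    (hsepX : ∀ u ∈ X, ∀ u' ∈ X, u ≠ u' → ⟪u, u'⟫ ≤ 1 - 1 / (2 * (101 / 100 : ℝ) ^ 2))
    (hB : ∀ T ∈ B, ∃ u ∈ X, ∃ u' ∈ X, u ≠ u' ∧ 1 - (101 / 100 : ℝ) ^ 2 / 2 ≤ ⟪u, u'⟫ ∧ T = {u, u'})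
    (hdeg : ∀ v ∈ X, ∃ w : Fin 4 → EuclideanSpace ℝ (Fin 3), (∀ k, w k ∈ X) ∧ Function.Injective w ∧ (∀ k, w k ≠ v) ∧ (∀ k, ({v, w k} : Finset (EuclideanSpace ℝ (Fin 3))) ∈ B) ∧ ∀ y, ({v, y} : Finset (EuclideanSpace ℝ (Fin 3))) ∈ B → ∃ k, y = w k) {v : EuclideanSpace ℝ (Fin 3)} (hv : v ∈ X)
    (h3 : ((facetNormals X).filter (fun c => v ∈ tightSet X c ∧ (tightSet X c).card = 3 ∧
      ((edgesOfFacet X c).filter (fun T => T ∉ B)).card = 0)).card = 3) :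
    ∃ c ∈ facetNormals X, v ∈ tightSet X c ∧
      (∃ T ∈ edgesOfFacet X c, T ∉ B ∧ v ∈ T) ∧
      (((tightSet X c).card = 3 ∧ 2 ≤ ((edgesOfFacet X c).filter (fun T => T ∉ B)).card) ∨
       ((tightSet X c).card ≠ 3 ∧ 1 ≤ ((edgesOfFacet X c).filter (fun T => T ∉ B)).card)) := by
  have h0 : (0 : EuclideanSpace ℝ (Fin 3)) ∈ interior (convexHull ℝ (X : Set (EuclideanSpace ℝ (Fin 3)))) :=
    zero_mem_interior_convexHull_of_twelve_le_card hT hX1 hcard.ge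
      (ca := 1 - 1 / (2 * (101 / 100 : ℝ) ^ 2)) (by norm_num) hsepX
  obtain ⟨w₀, hwX₀, hwinj₀, hwv₀, hvw₀, hvonly₀⟩ := hdeg v hv
  obtain ⟨w', hw'X, hw'inj, hw'v, hvw', hvonly'', hB01, hB12, hB23, -, -, -⟩ :=
    exists_path_family_of_three hX1 h0 hsepX hB hv w₀ hwX₀ hwinj₀ hwv₀ hvw₀ hvonly₀ h3
  have hvonly' : ∀ y ∈ X, ({v, y} : Finset (EuclideanSpace ℝ (Fin 3))) ∈ B → ∃ m, y = w' m :=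
    fun y _ hy => hvonly'' y hy
  obtain ⟨y, hyX, c, hcF, hyv, hnb, hEy, hvc, hyc, hslack⟩ :=
    exists_slack_facet_of_three_fan_one_percent hT hX1 hcard.ge hsepX
      (fun a b => ({a, b} : Finset (EuclideanSpace ℝ (Fin 3))) ∈ B) (close_of_mem_bonds hX1 hB) hv w'
      hw'X hw'inj hw'v
      hvw' hvonly' hB01 hB12 hB23
  have hside : ({v, y} : Finset (EuclideanSpace ℝ (Fin 3))) ∈ edgesOfFacet X c := by
    unfold edgesOfFacet
    rw [Finset.mem_filter]
    refine ⟨hEy, ?_⟩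
    intro x hx
    rw [Finset.mem_insert, Finset.mem_singleton] at hx
    rcases hx with rfl | rfl
    exacts [hvc, hyc]
  refine ⟨c, hcF, hvc, ⟨{v, y}, hside, hnb, Finset.mem_insert_self _ _⟩, ?_⟩
  rcases hslack with hne3 | ⟨z, hTz, hz⟩
  · right
    exact ⟨hne3, Finset.card_pos.2 ⟨{v, y}, Finset.mem_filter.2 ⟨hside, hnb⟩⟩⟩
  · left
    -- `v, y, z` are distinct since a facet has at least three tight points
    have h3le : 3 ≤ ({v, y, z} : Finset (EuclideanSpace ℝ (Fin 3))).card := by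
      rw [← hTz]; exact three_le_card_tightSet hcF
    have hzv : z ≠ v := by
      rintro rfl
      have : ({z, y, z} : Finset (EuclideanSpace ℝ (Fin 3))) ⊆ {z, y} := by
        intro x hx
        rw [Finset.mem_insert, Finset.mem_insert, Finset.mem_singleton] at hx
        rw [Finset.mem_insert, Finset.mem_singleton]
        tauto
      have := (Finset.card_le_card this).trans (Finset.card_le_two)
      omega
    have hzy : z ≠ y := by
      rintro rfl
      have : ({v, z, z} : Finset (EuclideanSpace ℝ (Fin 3))) ⊆ {v, z} := by
        intro x hx
        rw [Finset.mem_insert, Finset.mem_insert, Finset.mem_singleton] at hx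
        rw [Finset.mem_insert, Finset.mem_singleton]
        tauto
      have := (Finset.card_le_card this).trans (Finset.card_le_two)
      omega
    have h3c : (tightSet X c).card = 3 := by
      rw [hTz]; exact Finset.card_eq_three.2 ⟨v, y, z, hyv.symm, hzv.symm, hzy.symm, rfl⟩
    have hzc : z ∈ tightSet X c := by rw [hTz]; simp
    refine ⟨h3c, ?_⟩
    -- two distinct non-bond sides
    change 1 < ((edgesOfFacet X c).filter (fun T => T ∉ B)).card
    rw [Finset.one_lt_card]
    refine ⟨{v, y}, Finset.mem_filter.2 ⟨hside, hnb⟩, ?_⟩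
    rcases hz with hz | hz
    · refine ⟨{v, z}, Finset.mem_filter.2
        ⟨pair_mem_edgesOfFacet_of_card_three hX1 h0 hcF h3c hvc hzc hzv.symm, hz⟩, ?_⟩
      intro h
      have : y ∈ ({v, z} : Finset (EuclideanSpace ℝ (Fin 3))) := by
        rw [← h]; simp
      rw [Finset.mem_insert, Finset.mem_singleton] at this
      rcases this with h' | h'
      exacts [hyv h', hzy h'.symm]
    · refine ⟨{y, z}, Finset.mem_filter.2
        ⟨pair_mem_edgesOfFacet_of_card_three hX1 h0 hcF h3c hyc hzc hzy.symm, hz⟩, ?_⟩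
      intro h
      have : v ∈ ({y, z} : Finset (EuclideanSpace ℝ (Fin 3))) := by
        rw [← h]; simp
      rw [Finset.mem_insert, Finset.mem_singleton] at this
      rcases this with h' | h'
      exacts [hyv h'.symm, hzv h'.symm]

end Setting

end Summit.AtomisticToContinuum.Crystallization.Theorems.Cap
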